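import Summits.AtomisticToContinuum.Crystallization.Theorems.ChartedZeroExcessLayeredLatticeLiouvilleVE

/-!
# Zero-excess layered lattice Liouville — part VF (lens-2 g57, node «CrossLayerFlux»): the INTER-LAYER FLUX IDENTITY of the truncated operator.

The structural fact of the laminate in the STACKING direction (critic rows 909 (iii)(4) / 911 (ii): "to the stacking direction what
`isTruncHarmonicZ_latShift` is to the in-plane directions").  For a lattice field `φ`, the truncated linearised BOND FORCE on `X` from `Y` is
`bondF ϱ a b w φ X Y = nearK ϱ a b w X Y (φ Y − φ X)` (the summand of `truncResidual`, part UT); it is ANTISYMMETRIC under bond reversal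
(`bondF_swap`, from `nearK_comm` = evenness of `forceConst`).  The FLUX of `φ` through the gap above layer `m`, carried by the bonds of a finite
site set `Ω`, is `layerFlux ϱ a b w φ Ω m = Σ_{X ∈ Ω} Σ_{Y ∈ Ω} [X.2 ≤ m < Y.2] bondF X Y`.  Proved here, hypothesis-free:
* ★ `layerFlux_sub_layerFlux` — the DISCRETE DIVERGENCE IDENTITY `layerFlux Ω m − layerFlux Ω (m − 1) = Σ_{X ∈ Ω, X.2 = m} Σ_{Y ∈ Ω} bondF X Y`
  (pure antisymmetry: the in-layer double sum cancels);
* ★★ `layerFlux_sub_layerFlux_of_harmonic` — FLUX CONSERVATION: if `φ` has vanishing truncated residual at every site of layer `m` in `Ω` and `Ω`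
  contains every site within model distance `ϱ` of those sites, then `layerFlux Ω m = layerFlux Ω (m − 1)`; and the BOUNDARY FORM
  `layerFlux_sub_layerFlux_eq_neg_boundary` — in general the difference is minus the flux through the bonds leaving `Ω` from layer `m`.
Bricks of (LD) `LinearExcessDecayZ` (brick (4), the cross-layer chain); nothing of the column is re-typed, nothing here is an item.
-/

noncomputable section

open scoped BigOperators InnerProductSpace RealInnerProductSpace
open MeasureTheory Set Metric Filter Topology
open Summit.AtomisticToContinuum.Crystallization.Theorems.ChartedPlanarOrderRigidityDoor (E3 IsNash atomsIn)
open Summit.AtomisticToContinuum.Crystallization.Theorems.ChartedPlanarOrderDensityDichotomy (μS IsSep nK nK_nonneg)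
open Summit.AtomisticToContinuum.Crystallization.Theorems.ChartedPlanarOrderDoorLayered (Layered layeredHom_eq_layered)

namespace Summit.AtomisticToContinuum.Crystallization.Theorems.ChartedZeroExcessLayeredLatticeLiouville

section CrossLayerFlux

variable {c : ℝ} {a b : E3} {w : ℤ → E3}

/-! ### VF.1  The bond force and its antisymmetry -/

/-- the `ϱ`-truncated linearised BOND FORCE exerted on the site `X` by the site `Y` in the lattice field `φ` — the summand of `truncResidual`. [this file, g57] -/
def bondF (ϱ : ℝ) (a b : E3) (w : ℤ → E3) (φ : Cell 2 → ℤ → E3) (X Y : Cell 2 × ℤ) : E3 :=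
  nearK ϱ a b w X Y (φ Y.1 Y.2 - φ X.1 X.2)

/-- ★ BOND REVERSAL ANTISYMMETRY (action = reaction): `bondF φ Y X = −bondF φ X Y`. [this file, g57] -/
theorem bondF_swap (ϱ : ℝ) (a b : E3) (w : ℤ → E3) (φ : Cell 2 → ℤ → E3) (X Y : Cell 2 × ℤ) :
    bondF ϱ a b w φ Y X = -bondF ϱ a b w φ X Y := by
  unfold bondF
  rw [nearK_comm, ← nearK_neg, neg_sub]

/-- The self-bond carries no force. [formal bookkeeping] -/
theorem bondF_self (ϱ : ℝ) (a b : E3) (w : ℤ → E3) (φ : Cell 2 → ℤ → E3) (X : Cell 2 × ℤ) : bondF ϱ a b w φ X X = 0 := by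
  have h := bondF_swap ϱ a b w φ X X
  have h2 : (2 : ℝ) • bondF ϱ a b w φ X X = 0 := by
    rw [two_smul]
    nth_rewrite 1 [h]
    exact neg_add_cancel _
  exact (smul_eq_zero.mp h2).resolve_left two_ne_zero

/-- the truncated residual is the total bond force: `truncResidual φ X = Σ_{Y ∈ N} bondF φ X Y` for any finset `N` containing the near sites of `X`.
[formal bookkeeping] -/
theorem truncResidual_eq_sum_bondF {ϱ : ℝ} {X : Cell 2 × ℤ} {N : Finset (Cell 2 × ℤ)}
    (hN : ∀ Y : Cell 2 × ℤ, ‖lsite a b w Y.1 Y.2 - lsite a b w X.1 X.2‖ ≤ ϱ → Y ∈ N) (φ : Cell 2 → ℤ → E3) :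
    truncResidual ϱ a b w φ X = ∑ Y ∈ N, bondF ϱ a b w φ X Y :=
  truncResidual_eq_sum_nearK hN φ

/-- bonds longer than `ϱ` in the model carry no force. [formal bookkeeping] -/
theorem bondF_eq_zero_of_far {ϱ : ℝ} {φ : Cell 2 → ℤ → E3} {X Y : Cell 2 × ℤ} (h : ϱ < ‖lsite a b w Y.1 Y.2 - lsite a b w X.1 X.2‖) :
    bondF ϱ a b w φ X Y = 0 := by
  unfold bondF nearK
  rw [if_pos h]

/-- An antisymmetric kernel has vanishing double sum over a finite square. [formal bookkeeping] -/
theorem sum_sum_eq_zero_of_antisymm {S : Finset (Cell 2 × ℤ)} {g : Cell 2 × ℤ → Cell 2 × ℤ → E3} (hg : ∀ X Y, g Y X = -g X Y) :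
    ∑ X ∈ S, ∑ Y ∈ S, g X Y = 0 := by
  have h : ∑ X ∈ S, ∑ Y ∈ S, g X Y = -∑ X ∈ S, ∑ Y ∈ S, g X Y := by
    conv_lhs => rw [Finset.sum_comm]
    rw [← Finset.sum_neg_distrib]
    refine Finset.sum_congr rfl fun Y _ => ?_
    rw [← Finset.sum_neg_distrib]
    exact Finset.sum_congr rfl fun X _ => hg Y X
  have h2 : (2 : ℝ) • ∑ X ∈ S, ∑ Y ∈ S, g X Y = 0 := by
    rw [two_smul]
    nth_rewrite 1 [h]
    exact neg_add_cancel _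
  exact (smul_eq_zero.mp h2).resolve_left two_ne_zero

/-- A symmetrically WEIGHTED antisymmetric kernel has vanishing double sum. [formal bookkeeping] -/
theorem sum_sum_ite_eq_zero_of_symm {S : Finset (Cell 2 × ℤ)} {p : Cell 2 × ℤ → Cell 2 × ℤ → Prop} [∀ X Y, Decidable (p X Y)]
    (hp : ∀ X Y, p X Y ↔ p Y X) (ϱ : ℝ) (a b : E3) (w : ℤ → E3) (φ : Cell 2 → ℤ → E3) :
    ∑ X ∈ S, ∑ Y ∈ S, (if p X Y then bondF ϱ a b w φ X Y else 0) = 0 := by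
  refine sum_sum_eq_zero_of_antisymm fun X Y => ?_
  by_cases h : p X Y
  · rw [if_pos h, if_pos ((hp X Y).mp h), bondF_swap]
  · rw [if_neg h, if_neg (fun h' => h ((hp Y X).mp h')), neg_zero]

/-! ### VF.2  The inter-layer flux and the discrete divergence identity -/

/-- the INTER-LAYER FLUX of `φ` through the gap above layer `m`, carried by the bonds of the finite site set `Ω`:
`Σ_{X ∈ Ω, X.2 ≤ m} Σ_{Y ∈ Ω, m < Y.2} bondF φ X Y` (the force the part of `Ω` above the gap exerts on the part below). [this file, g57] -/
def layerFlux (ϱ : ℝ) (a b : E3) (w : ℤ → E3) (φ : Cell 2 → ℤ → E3) (Ω : Finset (Cell 2 × ℤ)) (m : ℤ) : E3 :=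
  ∑ X ∈ Ω, ∑ Y ∈ Ω, (if X.2 ≤ m ∧ m < Y.2 then bondF ϱ a b w φ X Y else 0)

/-- pointwise bookkeeping of the gap indicators: `[X.2 ≤ m < Y.2] − [X.2 ≤ m−1 < Y.2] = [X.2 = m] − ω(X, Y)` with the SYMMETRIC weight
`ω = [X.2 = m ∧ Y.2 ≤ m] + [X.2 < m ∧ Y.2 = m]`. [formal bookkeeping] -/
theorem gap_indicator_sub (m : ℤ) (X Y : Cell 2 × ℤ) (f : E3) :
    ((if X.2 ≤ m ∧ m < Y.2 then f else 0) - if X.2 ≤ m - 1 ∧ m - 1 < Y.2 then f else 0) =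
      (if X.2 = m then f else 0) -
        ((if X.2 = m ∧ Y.2 ≤ m then f else 0) + if X.2 < m ∧ Y.2 = m then f else 0) := by
  split_ifs <;> first | (exfalso; omega) | simp

/-- The weight `ω` is symmetric. [formal bookkeeping] -/
theorem gap_weight_symm (m : ℤ) (X Y : Cell 2 × ℤ) :
    (X.2 = m ∧ Y.2 ≤ m ∨ X.2 < m ∧ Y.2 = m) ↔ (Y.2 = m ∧ X.2 ≤ m ∨ Y.2 < m ∧ X.2 = m) := by
  omega

/-- ★ **THE DISCRETE DIVERGENCE IDENTITY**: `layerFlux Ω m − layerFlux Ω (m − 1) = Σ_{X ∈ Ω, X.2 = m} Σ_{Y ∈ Ω} bondF φ X Y` — the net flux into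
layer `m` through the two adjacent gaps is the total force on layer `m` from the bonds of `Ω` (the in-layer bonds cancel by antisymmetry).
Hypothesis-free. [this file, g57] -/
theorem layerFlux_sub_layerFlux (ϱ : ℝ) (a b : E3) (w : ℤ → E3) (φ : Cell 2 → ℤ → E3) (Ω : Finset (Cell 2 × ℤ)) (m : ℤ) :
    layerFlux ϱ a b w φ Ω m - layerFlux ϱ a b w φ Ω (m - 1) =
      ∑ X ∈ Ω.filter (fun X => X.2 = m), ∑ Y ∈ Ω, bondF ϱ a b w φ X Y := by
  have hω : ∑ X ∈ Ω, ∑ Y ∈ Ω, (if (X.2 = m ∧ Y.2 ≤ m ∨ X.2 < m ∧ Y.2 = m) then bondF ϱ a b w φ X Y else 0) = 0 :=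
    sum_sum_ite_eq_zero_of_symm (fun X Y => gap_weight_symm m X Y) ϱ a b w φ
  have hsplit : ∀ X Y : Cell 2 × ℤ, ((if X.2 = m ∧ Y.2 ≤ m then bondF ϱ a b w φ X Y else 0) +
      if X.2 < m ∧ Y.2 = m then bondF ϱ a b w φ X Y else 0) =
      (if (X.2 = m ∧ Y.2 ≤ m ∨ X.2 < m ∧ Y.2 = m) then bondF ϱ a b w φ X Y else 0) := by
    intro X Y
    split_ifs <;> first | (exfalso; omega) | simp
  unfold layerFlux
  rw [Finset.sum_filter, ← Finset.sum_sub_distrib]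
  have key : ∀ X ∈ Ω, ((∑ Y ∈ Ω, if X.2 ≤ m ∧ m < Y.2 then bondF ϱ a b w φ X Y else 0) -
      ∑ Y ∈ Ω, if X.2 ≤ m - 1 ∧ m - 1 < Y.2 then bondF ϱ a b w φ X Y else 0) =
      (if X.2 = m then ∑ Y ∈ Ω, bondF ϱ a b w φ X Y else 0) -
        ∑ Y ∈ Ω, (if (X.2 = m ∧ Y.2 ≤ m ∨ X.2 < m ∧ Y.2 = m) then bondF ϱ a b w φ X Y else 0) := by
    intro X _
    have hX : (if X.2 = m then ∑ Y ∈ Ω, bondF ϱ a b w φ X Y else 0) = ∑ Y ∈ Ω, (if X.2 = m then bondF ϱ a b w φ X Y else 0) := by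
      split_ifs
      · rfl
      · rw [Finset.sum_const_zero]
    rw [hX, ← Finset.sum_sub_distrib, ← Finset.sum_sub_distrib]
    refine Finset.sum_congr rfl fun Y _ => ?_
    rw [gap_indicator_sub, hsplit]
  rw [Finset.sum_congr rfl key, Finset.sum_sub_distrib, hω, sub_zero]

/-! ### VF.3  Flux conservation for truncated-harmonic fields -/

/-- ★★ **FLUX CONSERVATION ACROSS A HARMONIC LAYER**: if the truncated residual of `φ` vanishes at every site of layer `m` in `Ω`, and `Ω` contains
every site within model distance `ϱ` of those sites, then the flux through the gap above layer `m` equals the flux through the gap below it.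
[this file, g57] -/
theorem layerFlux_sub_layerFlux_of_harmonic {ϱ : ℝ} {φ : Cell 2 → ℤ → E3} {Ω : Finset (Cell 2 × ℤ)} {m : ℤ}
    (hres : ∀ X ∈ Ω, X.2 = m → truncResidual ϱ a b w φ X = 0)
    (hΩ : ∀ X ∈ Ω, X.2 = m → ∀ Y : Cell 2 × ℤ, ‖lsite a b w Y.1 Y.2 - lsite a b w X.1 X.2‖ ≤ ϱ → Y ∈ Ω) :
    layerFlux ϱ a b w φ Ω m = layerFlux ϱ a b w φ Ω (m - 1) := by
  rw [← sub_eq_zero, layerFlux_sub_layerFlux]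
  refine Finset.sum_eq_zero fun X hX => ?_
  rw [Finset.mem_filter] at hX
  rw [← truncResidual_eq_sum_bondF (hΩ X hX.1 hX.2) φ]
  exact hres X hX.1 hX.2

/-- the same from truncated harmonicity on a set `P` containing layer `m` of `Ω`. [formal bookkeeping] -/
theorem layerFlux_sub_layerFlux_of_isTruncHarmonicZ {ϱ : ℝ} {φ : Cell 2 → ℤ → E3} {P : Set (Cell 2 × ℤ)} {Ω : Finset (Cell 2 × ℤ)} {m : ℤ}
    (hφ : IsTruncHarmonicZ ϱ a b w φ P) (hP : ∀ X ∈ Ω, X.2 = m → X ∈ P)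
    (hΩ : ∀ X ∈ Ω, X.2 = m → ∀ Y : Cell 2 × ℤ, ‖lsite a b w Y.1 Y.2 - lsite a b w X.1 X.2‖ ≤ ϱ → Y ∈ Ω) :
    layerFlux ϱ a b w φ Ω m = layerFlux ϱ a b w φ Ω (m - 1) :=
  layerFlux_sub_layerFlux_of_harmonic (fun X hX hXm => truncResidual_eq_zero_of_isTruncHarmonicZ hφ (hP X hX hXm)) hΩ

/-- ★ iterated conservation: across a STACK of harmonic layers `m₀ < m' ≤ m₀ + k` the flux is constant. [this file, g57] -/
theorem layerFlux_eq_layerFlux_of_harmonic {ϱ : ℝ} {φ : Cell 2 → ℤ → E3} {Ω : Finset (Cell 2 × ℤ)} {m₀ : ℤ} {k : ℕ}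
    (hres : ∀ X ∈ Ω, m₀ < X.2 → X.2 ≤ m₀ + k → truncResidual ϱ a b w φ X = 0)
    (hΩ : ∀ X ∈ Ω, m₀ < X.2 → X.2 ≤ m₀ + k → ∀ Y : Cell 2 × ℤ, ‖lsite a b w Y.1 Y.2 - lsite a b w X.1 X.2‖ ≤ ϱ → Y ∈ Ω) :
    layerFlux ϱ a b w φ Ω (m₀ + k) = layerFlux ϱ a b w φ Ω m₀ := by
  induction k with
  | zero => simp
  | succ k ih =>
    have hk : (m₀ + ((k + 1 : ℕ) : ℤ)) - 1 = m₀ + (k : ℤ) := by push_cast; ring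
    rw [layerFlux_sub_layerFlux_of_harmonic (fun X hX hXm => hres X hX (by omega) (le_of_eq hXm))
      (fun X hX hXm => hΩ X hX (by omega) (le_of_eq hXm)), hk]
    exact ih (fun X hX h1 h2 => hres X hX h1 (by push_cast; omega)) (fun X hX h1 h2 => hΩ X hX h1 (by push_cast; omega))

/-- ★ THE BOUNDARY FORM: for a layer `m` of `Ω` on which the truncated residual vanishes, and any finset `N ⊇ Ω` containing all near sites of that layer,
`layerFlux Ω m − layerFlux Ω (m − 1) = −Σ_{X ∈ Ω, X.2 = m} Σ_{Y ∈ N \ Ω} bondF φ X Y` — the flux defect is the force carried by the bonds LEAVING `Ω`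
from layer `m` (the lateral boundary flux). [this file, g57] -/
theorem layerFlux_sub_layerFlux_eq_neg_boundary {ϱ : ℝ} {φ : Cell 2 → ℤ → E3} {Ω N : Finset (Cell 2 × ℤ)} {m : ℤ} (hΩN : Ω ⊆ N)
    (hres : ∀ X ∈ Ω, X.2 = m → truncResidual ϱ a b w φ X = 0)
    (hN : ∀ X ∈ Ω, X.2 = m → ∀ Y : Cell 2 × ℤ, ‖lsite a b w Y.1 Y.2 - lsite a b w X.1 X.2‖ ≤ ϱ → Y ∈ N) :
    layerFlux ϱ a b w φ Ω m - layerFlux ϱ a b w φ Ω (m - 1) =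
      -∑ X ∈ Ω.filter (fun X => X.2 = m), ∑ Y ∈ N \ Ω, bondF ϱ a b w φ X Y := by
  rw [layerFlux_sub_layerFlux, ← Finset.sum_neg_distrib]
  refine Finset.sum_congr rfl fun X hX => ?_
  rw [Finset.mem_filter] at hX
  have htot : ∑ Y ∈ N, bondF ϱ a b w φ X Y = 0 := by
    rw [← truncResidual_eq_sum_bondF (hN X hX.1 hX.2) φ]
    exact hres X hX.1 hX.2
  rw [← Finset.sum_sdiff hΩN] at htot
  rw [eq_neg_iff_add_eq_zero, add_comm]
  exact htot

/-! ### VF.4  First properties of the flux -/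

/-- the flux is additive in the field. [formal bookkeeping] -/
theorem layerFlux_add (ϱ : ℝ) (a b : E3) (w : ℤ → E3) (φ ψ : Cell 2 → ℤ → E3) (Ω : Finset (Cell 2 × ℤ)) (m : ℤ) :
    layerFlux ϱ a b w (φ + ψ) Ω m = layerFlux ϱ a b w φ Ω m + layerFlux ϱ a b w ψ Ω m := by
  unfold layerFlux
  rw [← Finset.sum_add_distrib]
  refine Finset.sum_congr rfl fun X _ => ?_
  rw [← Finset.sum_add_distrib]
  refine Finset.sum_congr rfl fun Y _ => ?_
  split_ifs
  · unfold bondF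
    rw [← nearK_add]
    congr 1
    simp only [Pi.add_apply]
    abel
  · rw [add_zero]

/-- the flux of a constant field vanishes. [formal bookkeeping] -/
theorem layerFlux_const (ϱ : ℝ) (a b : E3) (w : ℤ → E3) (v : E3) (Ω : Finset (Cell 2 × ℤ)) (m : ℤ) :
    layerFlux ϱ a b w (fun _ _ => v) Ω m = 0 := by
  unfold layerFlux bondF
  refine Finset.sum_eq_zero fun X _ => Finset.sum_eq_zero fun Y _ => ?_
  rw [sub_self]
  unfold nearK
  split_ifs <;> simp

/-- the flux through a gap outside the layer range of `Ω` vanishes (no bond of `Ω` crosses it). [formal bookkeeping] -/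
theorem layerFlux_eq_zero_of_forall_le {ϱ : ℝ} {φ : Cell 2 → ℤ → E3} {Ω : Finset (Cell 2 × ℤ)} {m : ℤ} (h : ∀ X ∈ Ω, X.2 ≤ m) :
    layerFlux ϱ a b w φ Ω m = 0 := by
  unfold layerFlux
  refine Finset.sum_eq_zero fun X _ => Finset.sum_eq_zero fun Y hY => ?_
  rw [if_neg (fun h' => not_le.mpr h'.2 (h Y hY))]

/-- Companion: no site of `Ω` lies at or below the gap. [formal bookkeeping] -/
theorem layerFlux_eq_zero_of_forall_lt {ϱ : ℝ} {φ : Cell 2 → ℤ → E3} {Ω : Finset (Cell 2 × ℤ)} {m : ℤ} (h : ∀ X ∈ Ω, m < X.2) :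
    layerFlux ϱ a b w φ Ω m = 0 := by
  unfold layerFlux
  refine Finset.sum_eq_zero fun X hX => Finset.sum_eq_zero fun Y _ => ?_
  rw [if_neg (fun h' => not_le.mpr (h X hX) h'.1)]

end CrossLayerFlux

end Summit.AtomisticToContinuum.Crystallization.Theorems.ChartedZeroExcessLayeredLatticeLiouville
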